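import Summits.ResolutionOfSingularities.ResolutionOfSingularities.Theses.UniversalCells
import Literature.AlgebraicGeometry.Resolution.PrincipalizationToResolution
import Literature.Barriers.ResolutionOfSingularities.QuasiExcellenceNecessaryScope
import HarnessLib

/-!
# `MatroidCellRes` — negative lemma: the open-immersion hypothesis is load-bearing

Support (negative) lemma for crux stmt-ResolutionOfSingularities-15230
(`Summit.ResolutionOfSingularities.ResolutionOfSingularities.Theses.UniversalCells.MatroidCellRes`,
route UniversalCells, rank 2: "every integral scheme `W` with an OPEN IMMERSION `i` into a partial
matroid stratum `P(p,m,Γ₊,Γ₀)` over `𝔽_p` is locally resolvable"), filed by the crux-attack refuter.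
This file declares no definition.

* `exists_integral_not_locallyResolvable_over` — over every affine scheme `Spec A` with an
  `𝔽_p`-point there is an INTEGRAL scheme `W → Spec A` (Nagata's one-dimensional Noetherian local
  domain of characteristic `p`, `Literature.Barriers.ResolutionOfSingularities.QuasiExcellence.nagata_not_hasResolution`,
  mapped to the `𝔽_p`-point) with a point `w` no open neighbourhood of which admits a resolution of
  singularities (`w` = the closed point, whose only open neighbourhood is `W` itself).
* `matroidCellRes_false_without_isOpenImmersion_at` / `matroidCellRes_false_without_isOpenImmersion` —
  the crux with the hypothesis `IsOpenImmersion i` DROPPED (any morphism `i : W → P(p,m,Γ₊,Γ₀)`) is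
  FALSE, at every prime `p` (instance `m = 0`, `Γ₊ = Γ₀ = ∅`, where the stratum is `Spec 𝔽_p` up to
  localisation at `1`).
* Reading for the provers: the crux's ONLY source of finite-type-ness / excellence of `W` is the open
  immersion `i` (integrality of `W` alone allows non-Japanese local domains); conversely any proof may
  weaken `IsOpenImmersion i` to `LocallyOfFiniteType i` without leaving the shadow of the summit
  (the summit implies the crux with `i` merely locally of finite type — crux-attack evidence
  `SummitImplies.lean` on the item).

## Sources
* J. Kollár, *Lectures on Resolution of Singularities* (2007), §1.13, Example 1.103, Thm. 1.101 —
  as vendored and PROVED in `Literature/Barriers/ResolutionOfSingularities/QuasiExcellenceNecessary*.lean`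
  (`nagata_not_hasResolution`, unconditional). Folklore otherwise.
-/

set_option linter.dupNamespace false

noncomputable section

open CategoryTheory AlgebraicGeometry TopologicalSpace
open Literature.AlgebraicGeometry.Resolution
open Literature.Barriers.ResolutionOfSingularities Literature.Barriers.ResolutionOfSingularities.QuasiExcellence

namespace Summit.ResolutionOfSingularities.ResolutionOfSingularities.Theorems.MatroidCellRes.Negative

/-- **Over every affine `𝔽_p`-pointed base there is an integral scheme that is not locally
resolvable**: Nagata's `Spec R` (a one-dimensional Noetherian local domain of characteristic `p`
with non-finite normalisation has no proper birational regular model; its closed point has no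
open neighbourhood other than `Spec R`). [cite: Kollar2007, Example 1.103 and Thm. 1.101] -/
theorem exists_integral_not_locallyResolvable_over {p : ℕ} (hp : p.Prime) (A : Type) [CommRing A]
    (ε : A →+* ZMod p) :
    ∃ (W : Scheme.{0}) (_ : W ⟶ Spec (.of A)) (w : W),
      IsIntegral W ∧ ¬ ∃ W' : W.Opens, w ∈ W' ∧ Scheme.HasResolution (W' : Scheme.{0}) := by
  obtain ⟨R, hR, hD, hN, hL, hchar, -, -, hres⟩ := nagata_not_hasResolution p hp
  -- `A → 𝔽_p → R`
  let ψ : ZMod p →+* R := ZMod.castHom (dvd_refl p) R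
  let φ : A →+* R := ψ.comp ε
  refine ⟨Spec (.of R), Spec.map (CommRingCat.ofHom φ), IsLocalRing.closedPoint R, inferInstance, ?_⟩
  rintro ⟨W', hw, hW'⟩
  -- the only open neighbourhood of the closed point is everything
  have htop : W' = ⊤ := (IsLocalRing.closedPoint_mem_iff (R := R) W').mp hw
  subst htop
  exact hres (Scheme.HasResolution.of_iso (Spec (.of R)).topIso.hom hW')

/-- **The crux without `IsOpenImmersion i` fails at every prime `p`** (instance `m = 0`,
`Γ₊ = Γ₀ = ∅`: the stratum ring `(𝔽_p[∅] ⧸ (∅))[1⁻¹]` has the `𝔽_p`-point "evaluate", and Nagata's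
integral `Spec R` maps to it). [cite: Kollar2007, Example 1.103 and Thm. 1.101] -/
theorem matroidCellRes_false_without_isOpenImmersion_at (p : ℕ) (hp : p.Prime) :
    let M : Matrix (Fin 3) (Fin 3 ⊕ Fin 0) (MvPolynomial (Fin 3 × Fin 0) (ZMod p)) :=
      Matrix.fromCols 1 (Matrix.of fun i j => MvPolynomial.X (i, j))
    let I : Ideal (MvPolynomial (Fin 3 × Fin 0) (ZMod p)) :=
      Ideal.span ((fun u : Fin 3 → Fin 3 ⊕ Fin 0 => (M.submatrix id u).det) ''
        (∅ : Set (Fin 3 → Fin 3 ⊕ Fin 0)))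
    ∃ (W : Scheme.{0})
      (_ : W ⟶ Spec (.of (Localization.Away (Ideal.Quotient.mk I
        (∏ u ∈ (∅ : Finset (Fin 3 → Fin 3 ⊕ Fin 0)), (M.submatrix id u).det)))))
      (w : W), IsIntegral W ∧ ¬ ∃ W' : W.Opens, w ∈ W' ∧ Scheme.HasResolution (W' : Scheme.{0}) := by
  intro M I
  have hI : I = ⊥ := by simp [I]
  -- the `𝔽_p`-point of the stratum: evaluate (there are no variables), pass to the quotient by
  -- `I = ⊥`, then to the localisation at `1`
  let e₁ : MvPolynomial (Fin 3 × Fin 0) (ZMod p) →+* ZMod p := MvPolynomial.eval fun _ => 0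
  have he₁ : ∀ a ∈ I, e₁ a = 0 := by
    intro a ha
    rw [hI, Ideal.mem_bot] at ha
    rw [ha, map_zero]
  let e₂ : (MvPolynomial (Fin 3 × Fin 0) (ZMod p) ⧸ I) →+* ZMod p := Ideal.Quotient.lift I e₁ he₁
  have hx : IsUnit (e₂ (Ideal.Quotient.mk I
      (∏ u ∈ (∅ : Finset (Fin 3 → Fin 3 ⊕ Fin 0)), (M.submatrix id u).det))) := by
    simp [e₂]
  let ε : Localization.Away (Ideal.Quotient.mk I
      (∏ u ∈ (∅ : Finset (Fin 3 → Fin 3 ⊕ Fin 0)), (M.submatrix id u).det)) →+* ZMod p :=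
    IsLocalization.Away.lift _ hx
  exact exists_integral_not_locallyResolvable_over hp _ ε

/-- **`IsOpenImmersion i` is load-bearing in `MatroidCellRes`**: the crux with that hypothesis
dropped — "every integral scheme `W` with ANY morphism `i` to a partial matroid stratum over `𝔽_p`
is locally resolvable" — is false (witness at `p = 2`, `m = 0`, `Γ₊ = Γ₀ = ∅`, `W` = Nagata's
`Spec R`). Any proof of the crux must use the open immersion (it is the only source of
finite-type-ness of `W`). [cite: Kollar2007, Example 1.103 and Thm. 1.101] -/
theorem matroidCellRes_false_without_isOpenImmersion :
    ¬ ∀ p : ℕ, p.Prime → ∀ (m : ℕ) (Γp : Finset (Fin 3 → Fin 3 ⊕ Fin m))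
        (Γ0 : Set (Fin 3 → Fin 3 ⊕ Fin m)),
      let M : Matrix (Fin 3) (Fin 3 ⊕ Fin m) (MvPolynomial (Fin 3 × Fin m) (ZMod p)) :=
        Matrix.fromCols 1 (Matrix.of fun i j => MvPolynomial.X (i, j))
      let I : Ideal (MvPolynomial (Fin 3 × Fin m) (ZMod p)) :=
        Ideal.span ((fun u : Fin 3 → Fin 3 ⊕ Fin m => (M.submatrix id u).det) '' Γ0)
      ∀ (W : Scheme.{0})
        (i : W ⟶ Spec (.of (Localization.Away (Ideal.Quotient.mk I
          (∏ u ∈ Γp, (M.submatrix id u).det))))),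
        IsIntegral W → ∀ w : W, ∃ W' : W.Opens, w ∈ W' ∧ Scheme.HasResolution (W' : Scheme.{0}) := by
  intro H
  obtain ⟨W, i, w, hW, hnot⟩ := matroidCellRes_false_without_isOpenImmersion_at 2 Nat.prime_two
  exact hnot (H 2 Nat.prime_two 0 ∅ ∅ W i hW w)

end Summit.ResolutionOfSingularities.ResolutionOfSingularities.Theorems.MatroidCellRes.Negative

end
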